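import Summits.QuantumFields.YangMills.Theorems.BalabanUVNodesN15CovariantLandauGreenRowLeibniz
import HarnessLib

/-!
# Route «BalabanUVNodes», node N15 = NE2, road (c) — PROGRAMME (P-S), XX: THE GLOBAL ROW OF THE FLAT GRADIENT OF THE COVARIANT PROPAGATOR, `∂G′(T)`, FROM THE THREE FLAT ROWS
# `G′(1)`, `G′(1)∂ᵀ`, `∂G′(1)`, THE ROW OF `G′(T)` (n15-c∕228) AND THE TRANSPORTER LETTERS — by a second Neumann series on the bond fields with the small operator
# `K₂ = ∂G′(1)·(Bᵀ − ℭ_W)` (Leibniz rule of n15-c∕224 on `∂ᵀB·G′(T)`) (dag-n15-c g23, n15-c∕229; HOME HANDOFF «BRICK D», file D2)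

Cell `pub-ymgap`, seat `pub-ymgap-dag-n15-c` (generation g23; R134 (a), s1; HUMAN RULING D-0062; chair R424 venue).  `bears_on: R4∕N15 · K3⁸ SpineGivenEndpointR13SepCoPHV
(stmt-QuantumFields-27366)`; filed `--supports stmt-QuantumFields-27366 --as helper` — COUNT-NEUTRAL.  Theorems only; 0 `sorry`.  Imports BY NAME n15-c∕228 and through it 224–227, 215, 213,
205, lit-balaban∕b11 `neumann_majorant`.  Nothing in the tree is modified.

WHY.  `∂G′(T) = ∂G′(1) + ∂G′(1)·(Δ′(1) − Δ′(T))·G′(T)` and, with `B = ∂ − D_T = 𝔇_W S`, the Leibniz rule `∂ᵀB·G′(T) = 𝔰_{div W}G′(T) − ℭ_W·∂G′(T)` (224) turns the only dangerous word into a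
SMALL operator on the unknown `∂G′(T)`: `∂G′(T) = S₂ + K₂·∂G′(T)`, `K₂ = ∂G′(1)(Bᵀ − ℭ_W)` (row `O(r)`), `S₂ = ∂G′(1) + ∂G′(1)𝔰G′(T) − ∂G′(1)BᵀBG′(T) − a∂G′(1)(…)G′(T)` (rows from the flat
`∂G′(1)` and the row of `G′(T)`, n15-c∕228).  `neumann_majorant` then bounds `∂G′(T)`; the covariant gradient row of n15-c∕217 (`hδD`) follows in D3 from `D_TG′(T) − ∂G′(1) =
(∂G′(T) − ∂G′(1)) − B·G′(T)`.
* §1 `hasMaj_bContr_if`, `cgrad_one_transpose_comp_B` (Leibniz as a `LinearMap` identity); §2 ★★★ **`hasMaj_cgrad_one_cGreen_of_flat'`**.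

HONEST FRAMING ∕ LIMITS.  Bookkeeping; the flat rows `C_G`, `C_A`, `C_D` and the row `X` of `G′(T)` are HYPOTHESES here (theorems by n15-c∕220∕228); MODEL carriers; NOT
[Balaban1985BackgroundPropagators] Lemma 3.3 ∕ Thm 3.4 as printed; NE2⁺ NOT PRINTED; N15 of record untouched (DISCHARGED AS CONSUMED, p687738); counts UNMOVED (typed 28∕28 · discharged 8∕27);
one finite 𝕋⁴ at fixed ε per index — NOT infinite volume ∕ OS ∕ mass gap ∕ Clay.  Restate-immune (no Theses import).
-/

noncomputable section

open scoped BigOperators Matrix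
open Finset

namespace Summit.QuantumFields.YangMills.BalabanUVNodes.N15.CovLandau

open Literature.MathematicalPhysics.QuantumFieldTheory.Balaban1983to89
open Literature.MathematicalPhysics.QuantumFieldTheory.Balaban1983to89.B5Prop11Plancherel (Tor fine unitVec)
open Literature.MathematicalPhysics.QuantumFieldTheory.Balaban1983to89.B11SectG (BlockNorm HasMaj RowSum hasMaj_comp_exp neumann_majorant)
open Literature.MathematicalPhysics.QuantumFieldTheory.Balaban1983to89.B6UnitTorusCarrier (unitTorusGeo rowSum_unitTorusGeo triangle254_unitTorusGeo unitTorusGeo_dist_nonneg)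
open Literature.MathematicalPhysics.QuantumFieldTheory.Balaban1983to89.T4EtaRateCoeffDefect (fibre mem_fibre)
open Literature.MathematicalPhysics.QuantumFieldTheory.King1986.Torus (blockOf tdistT tdistT_nonneg tdistT_symm tdistT_self)
open Summit.QuantumFields.YangMills.BalabanUVNodes.N15.MatrixSpecies (liftBlk)
open Summit.QuantumFields.YangMills.BalabanUVNodes.N15.CovAvg (cvaStair cvaStair_one)
open Summit.QuantumFields.YangMills.BalabanUVNodes.N15.BackgroundModel (kappa_ofBlocks)
open Summit.QuantumFields.YangMills.BalabanUVNodes.N15.DerivDefect (exists_const_hasMaj_ofBlocks)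
open Summit.QuantumFields.YangMills.BalabanUVNodes.N15.TwoGrid (hasMaj_smul_ofBlocks)
open Summit.QuantumFields.YangMills.BalabanUVNodes.N15.BlockRows (hasMaj_mulVecLin_of_sum_abs_le hasMaj_comp_localRight)

variable {d : ℕ}

section Grad

variable (M : Fin (d + 1) → ℕ) [∀ μ, NeZero (M μ)] (n : ℕ) [NeZero n] {ι : Type} [Fintype ι] [DecidableEq ι] (L k : ℕ)

/-! ## §1 Two bookkeeping pieces -/

/-- `ℭ_W` in block-diagonal form: majorant `𝟙[y = y′]·(d+1)w`. [folklore] -/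
theorem hasMaj_bContr_if (W : Fin (d + 1) → Tor (fine n M) → Matrix ι ι ℝ) {w : ℝ} (hw0 : 0 ≤ w) (hw : ∀ μ z i, ∑ j, |W μ z i j| ≤ w) :
    HasMaj (BlockNorm.ofBlocks (unitTorusGeo L k M) (liftBlk (fun b : Tor (fine n M) × Fin (d + 1) => blockOf n M b.1) ι)) (BlockNorm.ofBlocks (unitTorusGeo L k M) (liftBlk (blockOf n M) ι)) (Matrix.mulVecLin (bContr M n W)) (fun y y' => if y = y' then ((d : ℝ) + 1) * w else 0) := by
  classical
  refine hasMaj_mulVecLin_of_sum_abs_le _ _ (fun y y' => by positivity) fun q w' => ?_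
  change ∑ p ∈ fibre (liftBlk (fun b : Tor (fine n M) × Fin (d + 1) => blockOf n M b.1) ι) w', |bContr M n W q p| ≤ if blockOf n M q.1 = w' then ((d : ℝ) + 1) * w else 0
  by_cases hb : blockOf n M q.1 = w'
  · rw [if_pos hb]
    exact (Finset.sum_le_univ_sum_of_nonneg fun p => abs_nonneg _).trans (bContr_row_le M n W hw q)
  · rw [if_neg hb]
    refine le_of_eq (Finset.sum_eq_zero fun p hp => ?_)
    have hp1 : blockOf n M p.1.1 = w' := (mem_fibre (liftBlk (fun b : Tor (fine n M) × Fin (d + 1) => blockOf n M b.1) ι) w' p).1 hp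
    have : ¬ p.1.1 = q.1 := fun h => hb (by rw [← h]; exact hp1)
    simp [bContr, this]

/-- The Leibniz rule of n15-c∕224 as a `LinearMap` identity for `B = ∂ − D_T`: `∂ᵀ ∘ B = 𝔰_{div W} − ℭ_W ∘ ∂`, `W = n(1 − T)`. [cite: Balaban1985BackgroundPropagators, (3.58)–(3.62) p.402] -/
theorem cgrad_one_transpose_comp_B (T : Fin (d + 1) → Tor (fine n M) → Matrix ι ι ℝ) :
    Matrix.mulVecLin (cgrad M n (fun (_ : Fin (d + 1)) (_ : Tor (fine n M)) => (1 : Matrix ι ι ℝ)))ᵀ ∘ₗ Matrix.mulVecLin ((cgrad M n (fun (_ : Fin (d + 1)) (_ : Tor (fine n M)) => (1 : Matrix ι ι ℝ))) - cgrad M n T) = Matrix.mulVecLin (sDiag M n (bDiv M n (fun ν x => (n : ℝ) • ((1 : Matrix ι ι ℝ) - T ν x)))) - Matrix.mulVecLin (bContr M n (fun ν x => (n : ℝ) • ((1 : Matrix ι ι ℝ) - T ν x))) ∘ₗ Matrix.mulVecLin (cgrad M n (fun (_ : Fin (d + 1)) (_ : Tor (fine n M)) => (1 : Matrix ι ι ℝ)))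 := by
  refine LinearMap.ext fun f => ?_
  simp only [LinearMap.comp_apply, LinearMap.sub_apply, Matrix.mulVecLin_apply, cgrad_one_sub_eq_bMulShift, bMulShift_mulVec_eq]
  exact cgrad_one_transpose_mulVec_bDiag_bShift M n (fun ν x => (n : ℝ) • ((1 : Matrix ι ι ℝ) - T ν x)) f

/-! ## §2 The row of `∂G′(T)` -/

set_option maxHeartbeats 1000000 in
/-- ★★★ **THE GLOBAL ROW OF `∂G′(T)` FROM THE FLAT ROWS, THE ROW OF `G′(T)` AND THE TRANSPORTER LETTERS.**  Letters as n15-c∕228 plus the ROW Lipschitz letter `λ` of `T`; rows `G′(1)∂ᵀ ≤ C_A`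
`∂G′(1) ≤ C_De^{−δd}`, `G′(T) ≤ Xe^{−(δ−2s)d}`; smallness `θ₂c < 1`, `θ₂ = C_D(n(d+1)ρe^{δ})c + C_D(d+1)(nρ)`.  Then
`∂G′(T) ≤ A₂(1 − θ₂c)⁻¹e^{−(δ−3s)d}` with `A₂ = C_D + C_D(d+1)n(nλ)Xc + C_D(n(d+1)ρe^{δ+s})(nρe^{δ+s})c·Xc + |a|n^{−(d+1)}C_D(στ + σ)Xc`.
[cite: Balaban1985BackgroundPropagators, Thm 3.1 (3.42) p.397 (shape), Lemma 3.3 (3.55)–(3.62) p.402; Balaban1985Variational, (187)–(190) p.308 (Neumann)] -/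
theorem hasMaj_cgrad_one_cGreen_of_flat' {T : Fin (d + 1) → Tor (fine n M) → Matrix ι ι ℝ} (hT : ∀ ν x, IsUnit (T ν x)) {a : ℝ} (ha : 0 < a)
    {δ s c CD X ρ lam σ τ : ℝ} (hs : 0 < s) (hsδ : 3 * s ≤ δ) (hrow : RowSum (unitTorusGeo L k M) s c) (hc : 0 ≤ c)
    (hCD : 0 ≤ CD) (hX : 0 ≤ X) (hρ0 : 0 ≤ ρ) (hlam0 : 0 ≤ lam) (hσ0 : 0 ≤ σ) (hτ0 : 0 ≤ τ)
    (hρr : ∀ ν x i, ∑ j, |(T ν x - (fun (_ : Fin (d + 1)) (_ : Tor (fine n M)) => (1 : Matrix ι ι ℝ)) ν x) i j| ≤ ρ)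
    (hρc : ∀ ν x j, ∑ i, |(T ν x - (fun (_ : Fin (d + 1)) (_ : Tor (fine n M)) => (1 : Matrix ι ι ℝ)) ν x) i j| ≤ ρ)
    (hlamr : ∀ μ (z : Tor (fine n M)) i, ∑ j, |(T μ z - T μ (z - unitVec (fine n M) μ)) i j| ≤ lam)
    (hσr : ∀ y a' i, ∑ j, |(cvaStair M n (fun μ b => T μ b.1) y a' 0 - cvaStair M n (fun μ b => (fun (_ : Fin (d + 1)) (_ : Tor (fine n M)) => (1 : Matrix ι ι ℝ)) μ b.1) y a' 0) i j| ≤ σ)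
    (hσc : ∀ y a' j, ∑ i, |(cvaStair M n (fun μ b => T μ b.1) y a' 0 - cvaStair M n (fun μ b => (fun (_ : Fin (d + 1)) (_ : Tor (fine n M)) => (1 : Matrix ι ι ℝ)) μ b.1) y a' 0) i j| ≤ σ)
    (hτr : ∀ y a' i, ∑ j, |cvaStair M n (fun μ b => T μ b.1) y a' 0 i j| ≤ τ)
    (hD1 : HasMaj (BlockNorm.ofBlocks (unitTorusGeo L k M) (liftBlk (blockOf n M) ι)) (BlockNorm.ofBlocks (unitTorusGeo L k M) (liftBlk (fun b : Tor (fine n M) × Fin (d + 1) => blockOf n M b.1) ι)) (Matrix.mulVecLin ((cgrad M n (fun (_ : Fin (d + 1)) (_ : Tor (fine n M)) => (1 : Matrix ι ι ℝ))) * (cGreen M n (fun (_ : Fin (d + 1)) (_ : Tor (fine n M)) => (1 : Matrix ι ι ℝ)) a))) (fun y y' => CD * Real.exp (-(δ * tdistT M y y'))))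
    (hGT : HasMaj (BlockNorm.ofBlocks (unitTorusGeo L k M) (liftBlk (blockOf n M) ι)) (BlockNorm.ofBlocks (unitTorusGeo L k M) (liftBlk (blockOf n M) ι)) (Matrix.mulVecLin (cGreen M n T a)) (fun y y' => X * Real.exp (-((δ - 2 * s) * tdistT M y y'))))
    (hq : (CD * ((n : ℝ) * ((d + 1 : ℕ) * ρ) * Real.exp δ) * c + CD * (((d : ℝ) + 1) * ((n : ℝ) * ρ))) * c < 1) :
    HasMaj (BlockNorm.ofBlocks (unitTorusGeo L k M) (liftBlk (blockOf n M) ι)) (BlockNorm.ofBlocks (unitTorusGeo L k M) (liftBlk (fun b : Tor (fine n M) × Fin (d + 1) => blockOf n M b.1) ι)) (Matrix.mulVecLin ((cgrad M n (fun (_ : Fin (d + 1)) (_ : Tor (fine n M)) => (1 : Matrix ι ι ℝ))) * (cGreen M n T a)))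
      (fun y y' => (CD + CD * (((d : ℝ) + 1) * (n : ℝ) * ((n : ℝ) * lam)) * X * c + CD * (((n : ℝ) * ((d + 1 : ℕ) * ρ) * Real.exp (δ + s)) * ((n : ℝ) * ρ * Real.exp (δ + s)) * c) * c * X * c
          + |a| * (CD * (((n : ℝ) ^ (d + 1))⁻¹ * σ * τ)) * X * c + |a| * (CD * (((n : ℝ) ^ (d + 1))⁻¹ * 1 * σ)) * X * c)
        * (1 - (CD * ((n : ℝ) * ((d + 1 : ℕ) * ρ) * Real.exp δ) * c + CD * (((d : ℝ) + 1) * ((n : ℝ) * ρ))) * c)⁻¹ * Real.exp (-((δ - 3 * s) * tdistT M y y'))) := by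
  have hn : (0 : ℝ) < (n : ℝ) ^ (d + 1) := pow_pos (Nat.cast_pos.mpr (Nat.pos_of_ne_zero (NeZero.ne n))) _
  have hn1 : (0 : ℝ) ≤ (n : ℝ) := Nat.cast_nonneg n
  have hδ : 0 ≤ δ := by linarith
  have htri := triangle254_unitTorusGeo L k M
  have hd := unitTorusGeo_dist_nonneg L k M
  have h1unit : ∀ (ν : Fin (d + 1)) (x : Tor (fine n M)), IsUnit ((fun (_ : Fin (d + 1)) (_ : Tor (fine n M)) => (1 : Matrix ι ι ℝ)) ν x) := fun _ _ => isUnit_one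
  have hκS : (BlockNorm.ofBlocks (unitTorusGeo L k M) (liftBlk (blockOf n M) ι)).κ = 1 := kappa_ofBlocks _
  have hκV : (BlockNorm.ofBlocks (unitTorusGeo L k M) (liftBlk (fun b : Tor (fine n M) × Fin (d + 1) => blockOf n M b.1) ι)).κ = 1 := kappa_ofBlocks _
  have hκC : (BlockNorm.ofBlocks (unitTorusGeo L k M) (liftBlk (fun y : Tor M => y) ι)).κ = 1 := kappa_ofBlocks _
  -- local rows
  have hDDs := hasMaj_cgrad_sub M n L k T hρ0 (by linarith : 0 ≤ δ + s) hρr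
  have hDDt := hasMaj_cgrad_sub_transpose M n L k T hρ0 hδ hρc
  have hDDts := hasMaj_cgrad_sub_transpose M n L k T hρ0 (by linarith : 0 ≤ δ + s) hρc
  have hQQ := hasMaj_csavg_sub M n L k T hσ0 hσr
  have hQQt := hasMaj_csavg_sub_transpose M n L k T hσ0 hσc
  have hQ := hasMaj_csavg M n L k T hτ0 hτr
  have hQ1t := hasMaj_csavg_transpose M n L k (fun (_ : Fin (d + 1)) (_ : Tor (fine n M)) => (1 : Matrix ι ι ℝ)) zero_le_one (stair_one_cols M n)
  have hWr : ∀ μ x i, ∑ j, |(fun ν x => (n : ℝ) • ((1 : Matrix ι ι ℝ) - T ν x)) μ x i j| ≤ (n : ℝ) * ρ := by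
    intro μ x i
    have h := hρr μ x i
    calc ∑ j, |(fun ν x => (n : ℝ) • ((1 : Matrix ι ι ℝ) - T ν x)) μ x i j| = (n : ℝ) * ∑ j, |(T μ x - (fun (_ : Fin (d + 1)) (_ : Tor (fine n M)) => (1 : Matrix ι ι ℝ)) μ x) i j| := by
          rw [Finset.mul_sum]; refine Finset.sum_congr rfl fun j _ => ?_
          simp only [Matrix.smul_apply, smul_eq_mul, abs_mul, abs_of_nonneg hn1, Matrix.sub_apply, Matrix.one_apply]
          rw [abs_sub_comm]
      _ ≤ (n : ℝ) * ρ := mul_le_mul_of_nonneg_left h hn1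
  have hWlam : ∀ μ (z : Tor (fine n M)) i, ∑ j, |((fun ν x => (n : ℝ) • ((1 : Matrix ι ι ℝ) - T ν x)) μ (z - unitVec (fine n M) μ) - (fun ν x => (n : ℝ) • ((1 : Matrix ι ι ℝ) - T ν x)) μ z) i j| ≤ (n : ℝ) * lam := by
    intro μ z i
    have h := hlamr μ z i
    calc ∑ j, |((fun ν x => (n : ℝ) • ((1 : Matrix ι ι ℝ) - T ν x)) μ (z - unitVec (fine n M) μ) - (fun ν x => (n : ℝ) • ((1 : Matrix ι ι ℝ) - T ν x)) μ z) i j| = (n : ℝ) * ∑ j, |(T μ z - T μ (z - unitVec (fine n M) μ)) i j| := by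
          rw [Finset.mul_sum]; refine Finset.sum_congr rfl fun j _ => ?_
          simp only [Matrix.smul_apply, smul_eq_mul, Matrix.sub_apply]
          rw [← mul_sub, abs_mul, abs_of_nonneg hn1, sub_sub_sub_cancel_left]
      _ ≤ (n : ℝ) * lam := mul_le_mul_of_nonneg_left h hn1
  have hV : ∀ z i, ∑ j, |bDiv M n (fun ν x => (n : ℝ) • ((1 : Matrix ι ι ℝ) - T ν x)) z i j| ≤ ((d : ℝ) + 1) * (n : ℝ) * ((n : ℝ) * lam) := fun z i => rows_bDiv_le M n (fun ν x => (n : ℝ) • ((1 : Matrix ι ι ℝ) - T ν x)) hWlam z i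
  have hSD := hasMaj_sDiag_if M n L k (bDiv M n (fun ν x => (n : ℝ) • ((1 : Matrix ι ι ℝ) - T ν x))) (by positivity) hV
  have hCn := hasMaj_bContr_if M n L k (fun ν x => (n : ℝ) • ((1 : Matrix ι ι ℝ) - T ν x)) (by positivity) hWr
  -- signed versions of `B`, `Bᵀ`
  have hBs : HasMaj (BlockNorm.ofBlocks (unitTorusGeo L k M) (liftBlk (blockOf n M) ι)) (BlockNorm.ofBlocks (unitTorusGeo L k M) (liftBlk (fun b : Tor (fine n M) × Fin (d + 1) => blockOf n M b.1) ι)) (Matrix.mulVecLin ((cgrad M n (fun (_ : Fin (d + 1)) (_ : Tor (fine n M)) => (1 : Matrix ι ι ℝ))) - cgrad M n T)) (fun y y' => (n : ℝ) * ρ * Real.exp (δ + s) * Real.exp (-((δ + s) * tdistT M y y'))) := by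
    rw [show ((cgrad M n (fun (_ : Fin (d + 1)) (_ : Tor (fine n M)) => (1 : Matrix ι ι ℝ))) - cgrad M n T) = -(cgrad M n T - (cgrad M n (fun (_ : Fin (d + 1)) (_ : Tor (fine n M)) => (1 : Matrix ι ι ℝ)))) from (neg_sub _ _).symm, mulVecLin_neg']; exact hDDs.neg
  have hBt : HasMaj (BlockNorm.ofBlocks (unitTorusGeo L k M) (liftBlk (fun b : Tor (fine n M) × Fin (d + 1) => blockOf n M b.1) ι)) (BlockNorm.ofBlocks (unitTorusGeo L k M) (liftBlk (blockOf n M) ι)) (Matrix.mulVecLin ((cgrad M n (fun (_ : Fin (d + 1)) (_ : Tor (fine n M)) => (1 : Matrix ι ι ℝ))) - cgrad M n T)ᵀ) (fun y y' => (n : ℝ) * ((d + 1 : ℕ) * ρ) * Real.exp δ * Real.exp (-(δ * tdistT M y y'))) := by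
    rw [show ((cgrad M n (fun (_ : Fin (d + 1)) (_ : Tor (fine n M)) => (1 : Matrix ι ι ℝ))) - cgrad M n T) = -(cgrad M n T - (cgrad M n (fun (_ : Fin (d + 1)) (_ : Tor (fine n M)) => (1 : Matrix ι ι ℝ)))) from (neg_sub _ _).symm, Matrix.transpose_neg, mulVecLin_neg']; exact hDDt.neg
  have hBts : HasMaj (BlockNorm.ofBlocks (unitTorusGeo L k M) (liftBlk (fun b : Tor (fine n M) × Fin (d + 1) => blockOf n M b.1) ι)) (BlockNorm.ofBlocks (unitTorusGeo L k M) (liftBlk (blockOf n M) ι)) (Matrix.mulVecLin ((cgrad M n (fun (_ : Fin (d + 1)) (_ : Tor (fine n M)) => (1 : Matrix ι ι ℝ))) - cgrad M n T)ᵀ) (fun y y' => (n : ℝ) * ((d + 1 : ℕ) * ρ) * Real.exp (δ + s) * Real.exp (-((δ + s) * tdistT M y y'))) := by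
    rw [show ((cgrad M n (fun (_ : Fin (d + 1)) (_ : Tor (fine n M)) => (1 : Matrix ι ι ℝ))) - cgrad M n T) = -(cgrad M n T - (cgrad M n (fun (_ : Fin (d + 1)) (_ : Tor (fine n M)) => (1 : Matrix ι ι ℝ)))) from (neg_sub _ _).symm, Matrix.transpose_neg, mulVecLin_neg']; exact hDDts.neg
  have hBB : HasMaj (BlockNorm.ofBlocks (unitTorusGeo L k M) (liftBlk (blockOf n M) ι)) (BlockNorm.ofBlocks (unitTorusGeo L k M) (liftBlk (blockOf n M) ι)) (Matrix.mulVecLin ((cgrad M n (fun (_ : Fin (d + 1)) (_ : Tor (fine n M)) => (1 : Matrix ι ι ℝ))) - cgrad M n T)ᵀ ∘ₗ Matrix.mulVecLin ((cgrad M n (fun (_ : Fin (d + 1)) (_ : Tor (fine n M)) => (1 : Matrix ι ι ℝ))) - cgrad M n T))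
      (fun y y' => (BlockNorm.ofBlocks (unitTorusGeo L k M) (liftBlk (fun b : Tor (fine n M) × Fin (d + 1) => blockOf n M b.1) ι)).κ * ((n : ℝ) * ((d + 1 : ℕ) * ρ) * Real.exp (δ + s)) * ((n : ℝ) * ρ * Real.exp (δ + s)) * c * Real.exp (-(δ * tdistT M y y'))) :=
    hasMaj_comp_exp (ρ := δ) htri hd hrow (by positivity) (by positivity) hδ (by linarith) (by linarith) hBts hBs
  -- `K₂ = ∂G′(1)·(Bᵀ − ℭ_W)`
  set θ₂ : ℝ := CD * ((n : ℝ) * ((d + 1 : ℕ) * ρ) * Real.exp δ) * c + CD * (((d : ℝ) + 1) * ((n : ℝ) * ρ)) with hθ₂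
  have hθ₂0 : 0 ≤ θ₂ := by positivity
  have hK2 : HasMaj (BlockNorm.ofBlocks (unitTorusGeo L k M) (liftBlk (fun b : Tor (fine n M) × Fin (d + 1) => blockOf n M b.1) ι)) (BlockNorm.ofBlocks (unitTorusGeo L k M) (liftBlk (fun b : Tor (fine n M) × Fin (d + 1) => blockOf n M b.1) ι)) (Matrix.mulVecLin ((cgrad M n (fun (_ : Fin (d + 1)) (_ : Tor (fine n M)) => (1 : Matrix ι ι ℝ))) * (cGreen M n (fun (_ : Fin (d + 1)) (_ : Tor (fine n M)) => (1 : Matrix ι ι ℝ)) a)) ∘ₗ (Matrix.mulVecLin ((cgrad M n (fun (_ : Fin (d + 1)) (_ : Tor (fine n M)) => (1 : Matrix ι ι ℝ))) - cgrad M n T)ᵀ - Matrix.mulVecLin (bContr M n (fun ν x => (n : ℝ) • ((1 : Matrix ι ι ℝ) - T ν x))))) (fun y y' => θ₂ * Real.exp (-((δ - s) * tdistT M y y'))) := by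
    rw [LinearMap.comp_sub]
    have e1 := hasMaj_comp_exp (ρ := δ - s) htri hd hrow hCD (by positivity) (by linarith) (by linarith) (by linarith) hD1 hBt
    have e2' : HasMaj (BlockNorm.ofBlocks (unitTorusGeo L k M) (liftBlk (fun b : Tor (fine n M) × Fin (d + 1) => blockOf n M b.1) ι)) (BlockNorm.ofBlocks (unitTorusGeo L k M) (liftBlk (fun b : Tor (fine n M) × Fin (d + 1) => blockOf n M b.1) ι)) (Matrix.mulVecLin ((cgrad M n (fun (_ : Fin (d + 1)) (_ : Tor (fine n M)) => (1 : Matrix ι ι ℝ))) * (cGreen M n (fun (_ : Fin (d + 1)) (_ : Tor (fine n M)) => (1 : Matrix ι ι ℝ)) a)) ∘ₗ Matrix.mulVecLin (bContr M n (fun ν x => (n : ℝ) • ((1 : Matrix ι ι ℝ) - T ν x))))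
        (fun y y' => CD * (((d : ℝ) + 1) * ((n : ℝ) * ρ)) * Real.exp (-((δ - s) * tdistT M y y'))) :=
      ((hasMaj_comp_localRight hD1 hCn fun y y' => by positivity).mono fun y y' => le_of_eq (by rw [hκS]; ring)).of_rate_le hd (by positivity) (by linarith : δ - s ≤ δ)
    refine (e1.sub e2').mono fun y y' => le_of_eq ?_
    rw [hθ₂, hκS]; ring
  -- the source `S₂`
  have hs1 : HasMaj (BlockNorm.ofBlocks (unitTorusGeo L k M) (liftBlk (blockOf n M) ι)) (BlockNorm.ofBlocks (unitTorusGeo L k M) (liftBlk (fun b : Tor (fine n M) × Fin (d + 1) => blockOf n M b.1) ι)) ((Matrix.mulVecLin ((cgrad M n (fun (_ : Fin (d + 1)) (_ : Tor (fine n M)) => (1 : Matrix ι ι ℝ))) * (cGreen M n (fun (_ : Fin (d + 1)) (_ : Tor (fine n M)) => (1 : Matrix ι ι ℝ)) a)) ∘ₗ Matrix.mulVecLin (sDiag M n (bDiv M n (fun ν x => (n : ℝ) • ((1 : Matrix ι ι ℝ) - T ν x))))) ∘ₗ Matrix.mulVecLin (cGreen M n T a))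
      (fun y y' => (BlockNorm.ofBlocks (unitTorusGeo L k M) (liftBlk (blockOf n M) ι)).κ * (CD * (((d : ℝ) + 1) * (n : ℝ) * ((n : ℝ) * lam))) * X * c * Real.exp (-((δ - 3 * s) * tdistT M y y'))) := by
    have h1 : HasMaj (BlockNorm.ofBlocks (unitTorusGeo L k M) (liftBlk (blockOf n M) ι)) (BlockNorm.ofBlocks (unitTorusGeo L k M) (liftBlk (fun b : Tor (fine n M) × Fin (d + 1) => blockOf n M b.1) ι)) (Matrix.mulVecLin ((cgrad M n (fun (_ : Fin (d + 1)) (_ : Tor (fine n M)) => (1 : Matrix ι ι ℝ))) * (cGreen M n (fun (_ : Fin (d + 1)) (_ : Tor (fine n M)) => (1 : Matrix ι ι ℝ)) a)) ∘ₗ Matrix.mulVecLin (sDiag M n (bDiv M n (fun ν x => (n : ℝ) • ((1 : Matrix ι ι ℝ) - T ν x))))) (fun y y' => CD * (((d : ℝ) + 1) * (n : ℝ) * ((n : ℝ) * lam)) * Real.exp (-(δ * tdistT M y y'))) :=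
      (hasMaj_comp_localRight hD1 hSD fun y y' => by positivity).mono fun y y' => le_of_eq (by rw [hκS]; ring)
    exact hasMaj_comp_exp (ρ := δ - 3 * s) htri hd hrow (by positivity) hX (by linarith) (by linarith) (by linarith) h1 hGT
  have hs2 : HasMaj (BlockNorm.ofBlocks (unitTorusGeo L k M) (liftBlk (blockOf n M) ι)) (BlockNorm.ofBlocks (unitTorusGeo L k M) (liftBlk (fun b : Tor (fine n M) × Fin (d + 1) => blockOf n M b.1) ι)) ((Matrix.mulVecLin ((cgrad M n (fun (_ : Fin (d + 1)) (_ : Tor (fine n M)) => (1 : Matrix ι ι ℝ))) * (cGreen M n (fun (_ : Fin (d + 1)) (_ : Tor (fine n M)) => (1 : Matrix ι ι ℝ)) a)) ∘ₗ (Matrix.mulVecLin ((cgrad M n (fun (_ : Fin (d + 1)) (_ : Tor (fine n M)) => (1 : Matrix ι ι ℝ))) - cgrad M n T)ᵀ ∘ₗ Matrix.mulVecLin ((cgrad M n (fun (_ : Fin (d + 1)) (_ : Tor (fine n M)) => (1 : Matrix ι ι ℝ))) - cgrad M n T))) ∘ₗ Matrix.mulVecLin (cGreen M n T a))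
      (fun y y' => (BlockNorm.ofBlocks (unitTorusGeo L k M) (liftBlk (blockOf n M) ι)).κ * ((BlockNorm.ofBlocks (unitTorusGeo L k M) (liftBlk (blockOf n M) ι)).κ * CD * ((BlockNorm.ofBlocks (unitTorusGeo L k M) (liftBlk (fun b : Tor (fine n M) × Fin (d + 1) => blockOf n M b.1) ι)).κ * ((n : ℝ) * ((d + 1 : ℕ) * ρ) * Real.exp (δ + s)) * ((n : ℝ) * ρ * Real.exp (δ + s)) * c) * c) * X * c * Real.exp (-((δ - 3 * s) * tdistT M y y'))) := by
    have h1 := hasMaj_comp_exp (ρ := δ - s) htri hd hrow hCD (by rw [hκV]; positivity) (by linarith) (by linarith) (by linarith) hD1 hBB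
    exact hasMaj_comp_exp (ρ := δ - 3 * s) htri hd hrow (by rw [hκS, hκV]; positivity) hX (by linarith) (by linarith) (by linarith) h1 hGT
  have hs3 : HasMaj (BlockNorm.ofBlocks (unitTorusGeo L k M) (liftBlk (blockOf n M) ι)) (BlockNorm.ofBlocks (unitTorusGeo L k M) (liftBlk (fun b : Tor (fine n M) × Fin (d + 1) => blockOf n M b.1) ι)) ((Matrix.mulVecLin ((cgrad M n (fun (_ : Fin (d + 1)) (_ : Tor (fine n M)) => (1 : Matrix ι ι ℝ))) * (cGreen M n (fun (_ : Fin (d + 1)) (_ : Tor (fine n M)) => (1 : Matrix ι ι ℝ)) a)) ∘ₗ Matrix.mulVecLin ((csavg M n T - csavg M n (fun (_ : Fin (d + 1)) (_ : Tor (fine n M)) => (1 : Matrix ι ι ℝ)))ᵀ * csavg M n T)) ∘ₗ Matrix.mulVecLin (cGreen M n T a))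
      (fun y y' => (BlockNorm.ofBlocks (unitTorusGeo L k M) (liftBlk (blockOf n M) ι)).κ * (CD * (((n : ℝ) ^ (d + 1))⁻¹ * σ * τ)) * X * c * Real.exp (-((δ - 3 * s) * tdistT M y y'))) := by
    have hinner := hasMaj_comp_localRight hQQt hQ fun y y' => by positivity
    have hinner' : HasMaj (BlockNorm.ofBlocks (unitTorusGeo L k M) (liftBlk (blockOf n M) ι)) (BlockNorm.ofBlocks (unitTorusGeo L k M) (liftBlk (blockOf n M) ι)) (Matrix.mulVecLin ((csavg M n T - csavg M n (fun (_ : Fin (d + 1)) (_ : Tor (fine n M)) => (1 : Matrix ι ι ℝ)))ᵀ * csavg M n T)) (fun y y' => if y = y' then ((n : ℝ) ^ (d + 1))⁻¹ * σ * ((BlockNorm.ofBlocks (unitTorusGeo L k M) (liftBlk (fun y : Tor M => y) ι)).κ * τ) else 0) := by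
      rw [Matrix.mulVecLin_mul]; exact hinner.mono fun y y' => by split_ifs <;> simp
    have h1 : HasMaj (BlockNorm.ofBlocks (unitTorusGeo L k M) (liftBlk (blockOf n M) ι)) (BlockNorm.ofBlocks (unitTorusGeo L k M) (liftBlk (fun b : Tor (fine n M) × Fin (d + 1) => blockOf n M b.1) ι)) (Matrix.mulVecLin ((cgrad M n (fun (_ : Fin (d + 1)) (_ : Tor (fine n M)) => (1 : Matrix ι ι ℝ))) * (cGreen M n (fun (_ : Fin (d + 1)) (_ : Tor (fine n M)) => (1 : Matrix ι ι ℝ)) a)) ∘ₗ Matrix.mulVecLin ((csavg M n T - csavg M n (fun (_ : Fin (d + 1)) (_ : Tor (fine n M)) => (1 : Matrix ι ι ℝ)))ᵀ * csavg M n T)) (fun y y' => CD * (((n : ℝ) ^ (d + 1))⁻¹ * σ * τ) * Real.exp (-(δ * tdistT M y y'))) :=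
      (hasMaj_comp_localRight hD1 hinner' fun y y' => by positivity).mono fun y y' => le_of_eq (by rw [hκS, hκC]; ring)
    exact hasMaj_comp_exp (ρ := δ - 3 * s) htri hd hrow (by positivity) hX (by linarith) (by linarith) (by linarith) h1 hGT
  have hs4 : HasMaj (BlockNorm.ofBlocks (unitTorusGeo L k M) (liftBlk (blockOf n M) ι)) (BlockNorm.ofBlocks (unitTorusGeo L k M) (liftBlk (fun b : Tor (fine n M) × Fin (d + 1) => blockOf n M b.1) ι)) ((Matrix.mulVecLin ((cgrad M n (fun (_ : Fin (d + 1)) (_ : Tor (fine n M)) => (1 : Matrix ι ι ℝ))) * (cGreen M n (fun (_ : Fin (d + 1)) (_ : Tor (fine n M)) => (1 : Matrix ι ι ℝ)) a)) ∘ₗ Matrix.mulVecLin ((csavg M n (fun (_ : Fin (d + 1)) (_ : Tor (fine n M)) => (1 : Matrix ι ι ℝ)))ᵀ * (csavg M n T - csavg M n (fun (_ : Fin (d + 1)) (_ : Tor (fine n M)) => (1 : Matrix ι ι ℝ))))) ∘ₗ Matrix.mulVecLin (cGreen M n T a))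
      (fun y y' => (BlockNorm.ofBlocks (unitTorusGeo L k M) (liftBlk (blockOf n M) ι)).κ * (CD * (((n : ℝ) ^ (d + 1))⁻¹ * 1 * σ)) * X * c * Real.exp (-((δ - 3 * s) * tdistT M y y'))) := by
    have hinner := hasMaj_comp_localRight hQ1t hQQ fun y y' => by positivity
    have hinner' : HasMaj (BlockNorm.ofBlocks (unitTorusGeo L k M) (liftBlk (blockOf n M) ι)) (BlockNorm.ofBlocks (unitTorusGeo L k M) (liftBlk (blockOf n M) ι)) (Matrix.mulVecLin ((csavg M n (fun (_ : Fin (d + 1)) (_ : Tor (fine n M)) => (1 : Matrix ι ι ℝ)))ᵀ * (csavg M n T - csavg M n (fun (_ : Fin (d + 1)) (_ : Tor (fine n M)) => (1 : Matrix ι ι ℝ))))) (fun y y' => if y = y' then ((n : ℝ) ^ (d + 1))⁻¹ * 1 * ((BlockNorm.ofBlocks (unitTorusGeo L k M) (liftBlk (fun y : Tor M => y) ι)).κ * σ) else 0) := by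
      rw [Matrix.mulVecLin_mul]; exact hinner.mono fun y y' => by split_ifs <;> simp
    have h1 : HasMaj (BlockNorm.ofBlocks (unitTorusGeo L k M) (liftBlk (blockOf n M) ι)) (BlockNorm.ofBlocks (unitTorusGeo L k M) (liftBlk (fun b : Tor (fine n M) × Fin (d + 1) => blockOf n M b.1) ι)) (Matrix.mulVecLin ((cgrad M n (fun (_ : Fin (d + 1)) (_ : Tor (fine n M)) => (1 : Matrix ι ι ℝ))) * (cGreen M n (fun (_ : Fin (d + 1)) (_ : Tor (fine n M)) => (1 : Matrix ι ι ℝ)) a)) ∘ₗ Matrix.mulVecLin ((csavg M n (fun (_ : Fin (d + 1)) (_ : Tor (fine n M)) => (1 : Matrix ι ι ℝ)))ᵀ * (csavg M n T - csavg M n (fun (_ : Fin (d + 1)) (_ : Tor (fine n M)) => (1 : Matrix ι ι ℝ))))) (fun y y' => CD * (((n : ℝ) ^ (d + 1))⁻¹ * 1 * σ) * Real.exp (-(δ * tdistT M y y'))) :=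
      (hasMaj_comp_localRight hD1 hinner' fun y y' => by positivity).mono fun y y' => le_of_eq (by rw [hκS, hκC]; ring)
    exact hasMaj_comp_exp (ρ := δ - 3 * s) htri hd hrow (by positivity) hX (by linarith) (by linarith) (by linarith) h1 hGT
  set A₂ : ℝ := CD + CD * (((d : ℝ) + 1) * (n : ℝ) * ((n : ℝ) * lam)) * X * c + CD * (((n : ℝ) * ((d + 1 : ℕ) * ρ) * Real.exp (δ + s)) * ((n : ℝ) * ρ * Real.exp (δ + s)) * c) * c * X * c
          + |a| * (CD * (((n : ℝ) ^ (d + 1))⁻¹ * σ * τ)) * X * c + |a| * (CD * (((n : ℝ) ^ (d + 1))⁻¹ * 1 * σ)) * X * c with hA₂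
  have hA₂0 : 0 ≤ A₂ := by positivity
  have hS : HasMaj (BlockNorm.ofBlocks (unitTorusGeo L k M) (liftBlk (blockOf n M) ι)) (BlockNorm.ofBlocks (unitTorusGeo L k M) (liftBlk (fun b : Tor (fine n M) × Fin (d + 1) => blockOf n M b.1) ι)) (Matrix.mulVecLin ((cgrad M n (fun (_ : Fin (d + 1)) (_ : Tor (fine n M)) => (1 : Matrix ι ι ℝ))) * (cGreen M n (fun (_ : Fin (d + 1)) (_ : Tor (fine n M)) => (1 : Matrix ι ι ℝ)) a)) + (Matrix.mulVecLin ((cgrad M n (fun (_ : Fin (d + 1)) (_ : Tor (fine n M)) => (1 : Matrix ι ι ℝ))) * (cGreen M n (fun (_ : Fin (d + 1)) (_ : Tor (fine n M)) => (1 : Matrix ι ι ℝ)) a)) ∘ₗ Matrix.mulVecLin (sDiag M n (bDiv M n (fun ν x => (n : ℝ) • ((1 : Matrix ι ι ℝ) - T ν x))))) ∘ₗ Matrix.mulVecLin (cGreen M n T a)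
        - (Matrix.mulVecLin ((cgrad M n (fun (_ : Fin (d + 1)) (_ : Tor (fine n M)) => (1 : Matrix ι ι ℝ))) * (cGreen M n (fun (_ : Fin (d + 1)) (_ : Tor (fine n M)) => (1 : Matrix ι ι ℝ)) a)) ∘ₗ (Matrix.mulVecLin ((cgrad M n (fun (_ : Fin (d + 1)) (_ : Tor (fine n M)) => (1 : Matrix ι ι ℝ))) - cgrad M n T)ᵀ ∘ₗ Matrix.mulVecLin ((cgrad M n (fun (_ : Fin (d + 1)) (_ : Tor (fine n M)) => (1 : Matrix ι ι ℝ))) - cgrad M n T))) ∘ₗ Matrix.mulVecLin (cGreen M n T a)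
        - a • ((Matrix.mulVecLin ((cgrad M n (fun (_ : Fin (d + 1)) (_ : Tor (fine n M)) => (1 : Matrix ι ι ℝ))) * (cGreen M n (fun (_ : Fin (d + 1)) (_ : Tor (fine n M)) => (1 : Matrix ι ι ℝ)) a)) ∘ₗ Matrix.mulVecLin ((csavg M n T - csavg M n (fun (_ : Fin (d + 1)) (_ : Tor (fine n M)) => (1 : Matrix ι ι ℝ)))ᵀ * csavg M n T)) ∘ₗ Matrix.mulVecLin (cGreen M n T a))
        - a • ((Matrix.mulVecLin ((cgrad M n (fun (_ : Fin (d + 1)) (_ : Tor (fine n M)) => (1 : Matrix ι ι ℝ))) * (cGreen M n (fun (_ : Fin (d + 1)) (_ : Tor (fine n M)) => (1 : Matrix ι ι ℝ)) a)) ∘ₗ Matrix.mulVecLin ((csavg M n (fun (_ : Fin (d + 1)) (_ : Tor (fine n M)) => (1 : Matrix ι ι ℝ)))ᵀ * (csavg M n T - csavg M n (fun (_ : Fin (d + 1)) (_ : Tor (fine n M)) => (1 : Matrix ι ι ℝ))))) ∘ₗ Matrix.mulVecLin (cGreen M n T a)))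
      (fun y y' => A₂ * Real.exp (-((δ - 3 * s) * tdistT M y y'))) := by
    have h0 := hD1.of_rate_le hd hCD (by linarith : δ - 3 * s ≤ δ)
    have hs3' := hs3.mono fun y y' => le_of_eq (by rw [hκS, one_mul])
    have hs4' := hs4.mono fun y y' => le_of_eq (by rw [hκS, one_mul])
    have h3 := hasMaj_smul_ofBlocks (g := unitTorusGeo L k M) (liftBlk (fun b : Tor (fine n M) × Fin (d + 1) => blockOf n M b.1) ι) (K := fun y y' => (CD * (((n : ℝ) ^ (d + 1))⁻¹ * σ * τ)) * X * c * Real.exp (-((δ - 3 * s) * tdistT M y y'))) (fun y y' => by positivity) a hs3'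
    have h4 := hasMaj_smul_ofBlocks (g := unitTorusGeo L k M) (liftBlk (fun b : Tor (fine n M) × Fin (d + 1) => blockOf n M b.1) ι) (K := fun y y' => (CD * (((n : ℝ) ^ (d + 1))⁻¹ * 1 * σ)) * X * c * Real.exp (-((δ - 3 * s) * tdistT M y y'))) (fun y y' => by positivity) a hs4'
    refine ((((h0.add hs1).sub hs2).sub h3).sub h4).mono fun y y' => le_of_eq ?_
    rw [hA₂, hκS, hκV]; ring
  -- the fixed point `∂G′(T) = S₂ + K₂·∂G′(T)`
  have hGfix : (cGreen M n T a) = (cGreen M n (fun (_ : Fin (d + 1)) (_ : Tor (fine n M)) => (1 : Matrix ι ι ℝ)) a) + (cGreen M n (fun (_ : Fin (d + 1)) (_ : Tor (fine n M)) => (1 : Matrix ι ι ℝ)) a) * (claplA M n (fun (_ : Fin (d + 1)) (_ : Tor (fine n M)) => (1 : Matrix ι ι ℝ)) a - claplA M n T a) * (cGreen M n T a) := by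
    have h := cGreen_sub M n h1unit hT ha
    calc (cGreen M n T a) = (cGreen M n (fun (_ : Fin (d + 1)) (_ : Tor (fine n M)) => (1 : Matrix ι ι ℝ)) a) - ((cGreen M n (fun (_ : Fin (d + 1)) (_ : Tor (fine n M)) => (1 : Matrix ι ι ℝ)) a) - (cGreen M n T a)) := (sub_sub_cancel _ _).symm
      _ = (cGreen M n (fun (_ : Fin (d + 1)) (_ : Tor (fine n M)) => (1 : Matrix ι ι ℝ)) a) - (cGreen M n (fun (_ : Fin (d + 1)) (_ : Tor (fine n M)) => (1 : Matrix ι ι ℝ)) a) * (claplA M n T a - claplA M n (fun (_ : Fin (d + 1)) (_ : Tor (fine n M)) => (1 : Matrix ι ι ℝ)) a) * (cGreen M n T a) := by rw [h]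
      _ = (cGreen M n (fun (_ : Fin (d + 1)) (_ : Tor (fine n M)) => (1 : Matrix ι ι ℝ)) a) + (cGreen M n (fun (_ : Fin (d + 1)) (_ : Tor (fine n M)) => (1 : Matrix ι ι ℝ)) a) * (claplA M n (fun (_ : Fin (d + 1)) (_ : Tor (fine n M)) => (1 : Matrix ι ι ℝ)) a - claplA M n T a) * (cGreen M n T a) := by
          rw [show claplA M n (fun (_ : Fin (d + 1)) (_ : Tor (fine n M)) => (1 : Matrix ι ι ℝ)) a - claplA M n T a = -(claplA M n T a - claplA M n (fun (_ : Fin (d + 1)) (_ : Tor (fine n M)) => (1 : Matrix ι ι ℝ)) a) from (neg_sub _ _).symm, Matrix.mul_neg, Matrix.neg_mul, sub_eq_add_neg]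
  have hQ' : (csavg M n (fun (_ : Fin (d + 1)) (_ : Tor (fine n M)) => (1 : Matrix ι ι ℝ)))ᵀ * csavg M n (fun (_ : Fin (d + 1)) (_ : Tor (fine n M)) => (1 : Matrix ι ι ℝ)) - (csavg M n T)ᵀ * csavg M n T = -(((csavg M n T - csavg M n (fun (_ : Fin (d + 1)) (_ : Tor (fine n M)) => (1 : Matrix ι ι ℝ)))ᵀ * csavg M n T) + ((csavg M n (fun (_ : Fin (d + 1)) (_ : Tor (fine n M)) => (1 : Matrix ι ι ℝ)))ᵀ * (csavg M n T - csavg M n (fun (_ : Fin (d + 1)) (_ : Tor (fine n M)) => (1 : Matrix ι ι ℝ))))) := by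
    rw [Matrix.transpose_sub, Matrix.sub_mul, Matrix.mul_sub]; abel
  have hM : (cgrad M n (fun (_ : Fin (d + 1)) (_ : Tor (fine n M)) => (1 : Matrix ι ι ℝ))) * (cGreen M n T a) = (cgrad M n (fun (_ : Fin (d + 1)) (_ : Tor (fine n M)) => (1 : Matrix ι ι ℝ))) * (cGreen M n (fun (_ : Fin (d + 1)) (_ : Tor (fine n M)) => (1 : Matrix ι ι ℝ)) a) + (cgrad M n (fun (_ : Fin (d + 1)) (_ : Tor (fine n M)) => (1 : Matrix ι ι ℝ))) * (cGreen M n (fun (_ : Fin (d + 1)) (_ : Tor (fine n M)) => (1 : Matrix ι ι ℝ)) a) * ((claplA M n (fun (_ : Fin (d + 1)) (_ : Tor (fine n M)) => (1 : Matrix ι ι ℝ)) a - claplA M n T a) * (cGreen M n T a)) := by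
    conv_lhs => rw [hGfix]
    simp only [Matrix.mul_add, Matrix.mul_assoc]
  have hL := cgrad_one_transpose_comp_B M n T
  set Bm := ((cgrad M n (fun (_ : Fin (d + 1)) (_ : Tor (fine n M)) => (1 : Matrix ι ι ℝ))) - cgrad M n T) with hBm
  set Q1m := ((csavg M n T - csavg M n (fun (_ : Fin (d + 1)) (_ : Tor (fine n M)) => (1 : Matrix ι ι ℝ)))ᵀ * csavg M n T) with hQ1m
  set Q2m := ((csavg M n (fun (_ : Fin (d + 1)) (_ : Tor (fine n M)) => (1 : Matrix ι ι ℝ)))ᵀ * (csavg M n T - csavg M n (fun (_ : Fin (d + 1)) (_ : Tor (fine n M)) => (1 : Matrix ι ι ℝ)))) with hQ2m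
  set DG1 := (cgrad M n (fun (_ : Fin (d + 1)) (_ : Tor (fine n M)) => (1 : Matrix ι ι ℝ))) * (cGreen M n (fun (_ : Fin (d + 1)) (_ : Tor (fine n M)) => (1 : Matrix ι ι ℝ)) a) with hDG1
  have hfix : Matrix.mulVecLin ((cgrad M n (fun (_ : Fin (d + 1)) (_ : Tor (fine n M)) => (1 : Matrix ι ι ℝ))) * (cGreen M n T a)) =
      (Matrix.mulVecLin DG1 + (Matrix.mulVecLin DG1 ∘ₗ Matrix.mulVecLin (sDiag M n (bDiv M n (fun ν x => (n : ℝ) • ((1 : Matrix ι ι ℝ) - T ν x))))) ∘ₗ Matrix.mulVecLin (cGreen M n T a)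
        - (Matrix.mulVecLin DG1 ∘ₗ (Matrix.mulVecLin Bmᵀ ∘ₗ Matrix.mulVecLin Bm)) ∘ₗ Matrix.mulVecLin (cGreen M n T a)
        - a • ((Matrix.mulVecLin DG1 ∘ₗ Matrix.mulVecLin Q1m) ∘ₗ Matrix.mulVecLin (cGreen M n T a))
        - a • ((Matrix.mulVecLin DG1 ∘ₗ Matrix.mulVecLin Q2m) ∘ₗ Matrix.mulVecLin (cGreen M n T a)))
      + (Matrix.mulVecLin DG1 ∘ₗ (Matrix.mulVecLin Bmᵀ - Matrix.mulVecLin (bContr M n (fun ν x => (n : ℝ) • ((1 : Matrix ι ι ℝ) - T ν x))))) ∘ₗ Matrix.mulVecLin ((cgrad M n (fun (_ : Fin (d + 1)) (_ : Tor (fine n M)) => (1 : Matrix ι ι ℝ))) * (cGreen M n T a)) := by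
    conv_lhs => rw [hM, claplA_one_sub_claplA, hQ', ← hBm]
    simp only [Matrix.mulVecLin_add, mulVecLin_sub', mulVecLin_smul', mulVecLin_neg', Matrix.mulVecLin_mul, smul_neg, smul_add]
    rw [hL]
    simp only [LinearMap.comp_add, LinearMap.comp_sub, LinearMap.add_comp, LinearMap.sub_comp, LinearMap.comp_neg, LinearMap.neg_comp, LinearMap.comp_smul, LinearMap.smul_comp,
      LinearMap.comp_assoc]
    abel
  obtain ⟨M₀, hM₀, hap⟩ := exists_const_hasMaj_ofBlocks (g := unitTorusGeo L k M) (liftBlk (blockOf n M) ι) (liftBlk (fun b : Tor (fine n M) × Fin (d + 1) => blockOf n M b.1) ι) (Matrix.mulVecLin ((cgrad M n (fun (_ : Fin (d + 1)) (_ : Tor (fine n M)) => (1 : Matrix ι ι ℝ))) * (cGreen M n T a)))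
  have hq' : (BlockNorm.ofBlocks (unitTorusGeo L k M) (liftBlk (fun b : Tor (fine n M) × Fin (d + 1) => blockOf n M b.1) ι)).κ * θ₂ * c < 1 := by rw [hκV, one_mul]; exact hq
  have key := neumann_majorant (b₁ := (BlockNorm.ofBlocks (unitTorusGeo L k M) (liftBlk (blockOf n M) ι))) (b₂ := (BlockNorm.ofBlocks (unitTorusGeo L k M) (liftBlk (fun b : Tor (fine n M) × Fin (d + 1) => blockOf n M b.1) ι))) (ρ := δ - 3 * s) htri hd hrow hθ₂0 hA₂0 hM₀ (by linarith) (by linarith) hK2 hS hfix hap hq'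
  refine key.mono fun y y' => le_of_eq ?_
  rw [hκV, one_mul]

end Grad

end Summit.QuantumFields.YangMills.BalabanUVNodes.N15.CovLandau

end
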